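import Summits.QuantumFields.YangMills.Theses.EquipartitionCriticality
import Summits.QuantumFields.YangMills.Theorems.EquipartitionCriticalityEquipartitionPinsProbeReduction
import Summits.QuantumFields.YangMills.Theorems.EquipartitionCriticalityEquipartitionPinsProbeLocalLaw
import HarnessLib

/-!
# `EquipartitionPinsProbe` (crux `stmt-QuantumFields-8760` of route `EquipartitionCriticality`, line `Sketch`)

Route `EquipartitionCriticality` of `QuantumFields/YangMills`, crux
`Summit.QuantumFields.YangMills.Theses.EquipartitionCriticality.EquipartitionPinsProbe`: for every compact
simple `G` and faithful unitary lattice representation `r`, IF the torus free energy per site of 4-D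
Wilson lattice gauge theory satisfies `f_r(β) + (3D/2) log β → K` (`D = dim 𝔤_r`), THEN there are a
bounded continuous probe `φ` and a positive, sub-exponentially decaying profile `g : ℕ → ℝ` such that the
time-covariances of `φ(β(N − Re tr r(U_p)))` at distance `n` converge to `g(n)` as `β → ∞`, uniformly over
torus-limit states `μ ∈ infiniteVolumeLimitPoints r.ρ β`.

Proof = the line `Sketch` of the crux chain (leads gen 0, c1, c2, c3; ideas `stein-liouville-pinning`,
`sd-bochner-covariance-rigidity`): the reduction `crux ⇐ local free-gluon law`
(`equipartitionPinsProbe_of_localLaw`, probe `φ(x) = e^{−2x₊}`, profile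
`g_D(n) = 2^{−D}((1 − c_n²)^{−D/2} − 1)`, `c_n` the lattice-Maxwell plaquette two-point numbers, which is
positive and decays like `n⁻⁸`) applied to the local free-gluon law `stub_localLaw` (uniform equipartition
from the log-coefficient ⇒ tangent laws of the rescaled plaquette field `Y^β = dA^β` in the comb gauge
exist, are closed, budgeted and Stein — the last by differentiating the one-link skew Haar-shift identity of
torus-limit states — and rigidity identifies them with the lattice Maxwell field `curvatureGaussianField`).
References: S. Chatterjee, arXiv:1602.01222; C. Garban, A. Sepúlveda, arXiv:2107.04021. [arXiv160201222] [GarbanSepulveda2023]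
-/

noncomputable section

namespace Summit.QuantumFields.YangMills.Theorems

/-- **The crux `EquipartitionPinsProbe` of route `EquipartitionCriticality` holds**: the reduction to the
local free-gluon law (`EquipartitionPinsProbe.equipartitionPinsProbe_of_localLaw`) applied to the local
free-gluon law (`EquipartitionPinsProbe.stub_localLaw`). -/
theorem EquipartitionPinsProbe_proof :
    Summit.QuantumFields.YangMills.Theses.EquipartitionCriticality.EquipartitionPinsProbe :=
  EquipartitionPinsProbe.equipartitionPinsProbe_of_localLaw EquipartitionPinsProbe.stub_localLaw

end Summit.QuantumFields.YangMills.Theorems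

end
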